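import Summits.FinalStateConjecture.FinalStateConjecture.Theses.LapseTrumpetKID
import Literature.Geometry.Lorentzian.NormalisedMaximalFoliation
import Literature.Geometry.Lorentzian.TrumpetModel
import Literature.Geometry.Lorentzian.LeafAdaptedModelCharts
import HarnessLib.Audit

/-!
# Birth skeleton (BC3) — crux `SettlingInMaximalGauge` (stmt-FinalStateConjecture-17999)

Registrar: planner-skel-stmt-FinalStateConjecture-17999-0, 2026-08-17 (route re-audit bin
REPAIRABLE; published as `Cruxes/SettlingInMaximalGauge/Lines/birth.lean`).  Route
`route-FinalStateConjecture-LapseTrumpetKID`, crux decl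
`Summit.FinalStateConjecture.FinalStateConjecture.Theses.LapseTrumpetKID.SettlingInMaximalGauge`
(rank 3; rev ≥ 4, the T2 form: conclusion `O = exteriorOf 𝒟 d.charted ∧ RaysStayInClosure 𝒟 O ∧
HasExhaustiveCharts d ∧ IsFutureOriented d`).  The crux is FIXED and is concluded BY NAME by
`SettlingInMaximalGauge_of` below; no `sorry` outside the three `stub_*`.

## The cut = the route's own layer-2 plan, typed with the landed definition items

The route header (TWO-LAYER PLAN / NOT DECOMPOSED YET) prescribes
`SettlingInMaximalGauge ⇐ TrumpetLimits → TrumpetKIDRigidity → SliceDictionary`, with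
`TrumpetLimits` left informal at open because its inline form (5.6k chars) exceeded the 4k
signature cap, "to get its signature once the definition items `IsNormalisedMaximalFoliation` /
`IsTrumpetModel` / `LeafAdaptedModelCharts` land", and with the T2 upgrade "RaysStayInClosure (Cauchy
leaves + complete 𝓘⁺ …) and IsFutureOriented (∂ₜF future-pointing, boosts orthochronous) enter
TrumpetLimits / SliceDictionary when the split is filed".  All three definitions HAVE landed
(`Literature/Geometry/Lorentzian/{NormalisedMaximalFoliation,TrumpetModel,LeafAdaptedModelCharts}.lean`,
each VERBATIM the route's inline clauses with `Iff.rfl` unfolding lemmas), so the plan is typable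
today without any cap, and this file types it:

* `stub_trumpetLimits` (XL, open problem — THE LOAD-BEARING STUB; T2 form of the informal item
  stmt-FinalStateConjecture-10187 `TrumpetLimits`): for an admissible datum, an MGHD `𝒟` with
  complete `𝓘⁺` and a normalised maximal Cauchy foliation `(F, ν)` with trapped lapse wells, there
  are `n` x⁰-STATIONARY VACUUM TRUMPET MODELS `(Uᵢ, γᵢ)` (`IsTrumpetModel`), LEAF-ADAPTED late model
  charts `Φᵢ`, a leaf-adapted flat chart `Φ₀` on `U₀`, radii, tracks and excisions forming
  `LeafAdaptedModelCharts 𝒟 F n U γ b ρ Φ R U₀ Φ₀ τ₀ ξ v ς` (C² convergence on growing truncations,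
  separation, far-field flatness, straight subluminal tracks, exhaustion of
  `J⁺(ιX) ∩ I⁻(Φ₀(late))`), AND (T2, rays half) every future-complete normalised null ray from the
  data stays in the closure of the exterior region determined by the late RADIATION ZONE alone,
  however late: `∀ T ≥ τ₀, RaysStayInClosure 𝒟 (exteriorOf 𝒟 (Φ₀ '' {x⁰ > T}))`.
* `stub_trumpetKIDRigidity` (open problem; BY DEFINITION the sibling crux
  `Theses.LapseTrumpetKID.TrumpetKIDRigidity`, stmt-FinalStateConjecture-10161 — see the `Iff.rfl`
  example below): a stationary vacuum trumpet model embeds time-equivariantly into sub-extremal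
  Kerr–Schild Kerr, `IsTrumpetModel U γ → IsKerrEmbeddedStationary U γ`.
* `stub_sliceDictionary` (XL; the T2 upgrade of the support item stmt-FinalStateConjecture-10162
  `SliceDictionary`, orientation half of T2): Kerr-embedded trumpet models with leaf-adapted charts
  along a normalised maximal Cauchy foliation yield `O`, a typed `FinalStateDecomposition 𝒟 O 2`
  with sub-extremal parameters, `O = exteriorOf 𝒟 d.charted`, RETENTION of the radiation zone
  (`Φ₀ '' {x⁰ > T} ⊆ d.charted` for some `T ≥ τ₀`), `HasExhaustiveCharts d` and `IsFutureOriented d`.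

`SettlingInMaximalGauge_of : stub₁-sig → stub₂-sig → stub₃-sig → SettlingInMaximalGauge` is PROVED
below: the crux's inline foliation / trapped-wells clauses ARE `IsNormalisedMaximalFoliation` /
`HasTrappedWells` (`Iff.rfl` lemmas of the Literature file); stub 1 gives models and charts; stub 2
Kerr-embeds every model; stub 3 builds `(O, d)`; the rays clause is transported from
`exteriorOf 𝒟 (Φ₀ '' {x⁰ > T})` to `O = exteriorOf 𝒟 d.charted` by monotonicity of `I⁻`, of
`exteriorOf` and of `RaysStayInClosure` in the region (lemmas `chronologicalPast_mono'`,
`exteriorOf_mono`, `raysStayInClosure_mono` proved here, sorry-free).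

Disproof used: none exists for this crux (no `Cruxes/SettlingInMaximalGauge/Disproof.lean`, no
`Theorems/SettlingInMaximalGauge/Negative/*`, payload `disproof_path` absent; `ledger crux ls`:
"no workfiles yet", 2026-08-17).  Negatives index (1 entry, `not_UniformPhotonSphereChannels`, an
ODE statement about Schwarzschild photon-sphere channels): no stub restates it.

BC3 probes (registrar, 2026-08-17; files `bc/stub_<name>_probe.lean` in the registrar's folder, each
with the stub signature copied verbatim as a local `def Stub` and NO sorried declaration in scope):
for each of the three stubs, `example : Stub → SettlingInMaximalGauge` and
`example : Stub → _root_.FinalStateConjecture` by `first | exact? | simpa | aesop` and by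
`first | exact? | simpa [Stub] | (unfold Stub; simpa) | aesop` under `maxHeartbeats 400000` ALL
FAIL (12/12: `exact?` no hit, `simpa` no progress / whnf timeout on the unfolded Π-type, `aesop:
failed to prove the goal after exhaustive search`) — no stub is cheaply the crux or the summit.
Stub 2 is by design the sibling route item `TrumpetKIDRigidity` (a registered obligation, carried
by `closes` as its fourth hypothesis for exactly this split), not a restatement of THIS crux.
-/

noncomputable section

open scoped Manifold ContDiff Topology
open Filter Set TopologicalSpace Literature.Geometry.Lorentzian

namespace Summit.FinalStateConjecture.FinalStateConjecture.Cruxes.SettlingInMaximalGauge.Birth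

set_option linter.dupNamespace false
set_option linter.unusedVariables false

/-! ## Monotonicity of the T2 rays clause in the region (sorry-free glue lemmas) -/

section Mono

variable {X : Type} [TopologicalSpace X] [ChartedSpace E3 X] [IsManifold (𝓡 3) ∞ X]
  [ConnectedSpace X] {D : InitialDataSet (𝓡 3) X}

/-- `I⁻` is monotone in the set (`chronologicalPast` unfolds to `chronologicalFuture` for the
reversed time orientation, which is monotone: `LorentzianMetric.chronologicalFuture_mono`). -/
theorem chronologicalPast_mono' (𝒟 : CauchyDevelopment D) {S T : Set 𝒟.carrier} (h : S ⊆ T) :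
    𝒟.metric.chronologicalPast 𝒟.timeOrientation S ⊆
      𝒟.metric.chronologicalPast 𝒟.timeOrientation T :=
  LorentzianMetric.chronologicalFuture_mono h

/-- The self-determined exterior region `exteriorOf 𝒟 U = J⁺(ι X) ∩ I⁻(U)` is monotone in the
charted set `U`. -/
theorem exteriorOf_mono (𝒟 : CauchyDevelopment D) {U V : Set 𝒟.carrier} (h : U ⊆ V) :
    Summit.FinalStateConjecture.exteriorOf 𝒟 U ⊆ Summit.FinalStateConjecture.exteriorOf 𝒟 V :=
  inter_subset_inter_right _ (chronologicalPast_mono' 𝒟 h)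

/-- `RaysStayInClosure 𝒟 O` is monotone in `O`: rays staying in `closure O` stay in
`closure O'` for `O ⊆ O'`. -/
theorem raysStayInClosure_mono (𝒟 : CauchyDevelopment D) {O O' : Set 𝒟.carrier} (h : O ⊆ O')
    (hO : Summit.FinalStateConjecture.RaysStayInClosure 𝒟 O) :
    Summit.FinalStateConjecture.RaysStayInClosure 𝒟 O' := by
  intro inst p γ dom hγ hdom t ht h0
  exact closure_mono h (hO p γ dom hγ hdom t ht h0)

end Mono

/-! ## The three registered stubs -/

/-- **Registered stub 1 — TRUMPET LIMITS, T2 form** (XL, open problem; THE LOAD-BEARING STUB; the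
typed form of the route's informal layer-2 item `TrumpetLimits`, stmt-FinalStateConjecture-10187,
plus the rays half of the T2 upgrade).  For an admissible datum `D`, an MGHD `𝒟` with complete
`𝓘⁺`, and a normalised maximal Cauchy foliation `(F, ν)` of `𝒟` (`IsNormalisedMaximalFoliation`:
smooth, leaves Cauchy and smoothly embedded with future unit normals `ν`, induced data maximal,
complete, AF of order 1 with a sole end, lapse `N = -g(∂ₜF, ν) > 0`, `N(t,·) → 1` at infinity for
`t ≥ 0`) whose lapse wells are trapped (`HasTrappedWells`), there exist: `n` x⁰-stationary vacuum
trumpet models `(Uᵢ, γᵢ)` (`IsTrumpetModel`: time-invariant domain, `x⁰`-independent Ricci-flat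
metric, `γ(∂₀,∂₀)` bounded above, slab `{x⁰ = 0} ≅ ℝ³ ∖ {0}` a complete maximal AF trumpet slab with
positive lapse `→ 1` at the flat end, `→ 0` down the trumpet, small-lapse region causally cut off
from the far world tube), and LEAF-ADAPTED late model charts (`LeafAdaptedModelCharts`): `Φᵢ : Uᵢ → 𝒟`
late charts mapping the model slab `{x⁰ = t}` into the leaf `F({t} × X)` and into `J⁺(ι X)`, proper
truncations `ρᵢ`, radii `Rᵢ(t) → ∞` with `‖Φᵢ^* g − γᵢ‖_{C²({x⁰ = t, ρᵢ ≤ Rᵢ(t)})} → 0`, truncated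
tubes eventually pairwise disjoint, a leaf-adapted flat chart `Φ₀` on
`U₀ ⊇ {τ₀ < t, ςᵢ(t) < |y − ξᵢ(t)| ∀ i}` with `‖Φ₀^* g − η‖_{C²({x⁰ = t})} → 0`, straight subluminal
tracks `ξᵢ(t) = t vᵢ + o(t)`, `|vᵢ| < 1`, sublinear excisions `ςᵢ = o(t)`, and EXHAUSTION of
`J⁺(ι X) ∩ I⁻(Φ₀({x⁰ > τ₀}))` by the certified late regions / slabs; AND (T2, rays) for every
`T ≥ τ₀` every future-complete normalised null ray from the data stays in
`closure (J⁺(ι X) ∩ I⁻(Φ₀({x⁰ > T})))` — the settled region contains, up to closure, every event on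
a future-complete null ray from `Σ`, and is pinned by the radiation zone alone.
Intended proof (route header, card collapse-of-the-lapse-trumpet-kid K2 ⊕ K4): along the maximal
foliation the lapse collapses exactly inside the holes (trapped wells), the leaves avoid the
singular / Cauchy-horizon interior and pile up on limit maximal cylinders; pointed `C²` limits of
`(h_t, k_t, N_t)` at the separating wells exist (elliptic gauge: `Δ N = |k|² N`, `R = |k|² ≥ 0`,
Bartnik / Christodoulou–Klainerman interior estimates; a limit with `∂ₜ(h,k,N,β) → 0` is a Killing
initial data set, Beig–Chruściel gr-qc/9604040, so stationarity of ω-limits is definitional) and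
are trumpet models; the well census is finite and wells separate on straight sublinear tracks
(Bondi mass loss finite, final recoil velocities `< 1`); the far limit is flat
(Christodoulou–Klainerman); exhaustion because every late leaf is Cauchy; rays: a future-complete
null ray from `Σ` crosses every late leaf (Cauchy), and does so outside the frozen well interiors
(inside a trapped well every causal geodesic of the MGHD is future-incomplete — it runs into the
crushing / Cauchy-horizon end avoided by the leaves), hence in the closure of the past of the
radiation zone.  Why it might fail: it is the deterministic large-data decay problem given only
the gauge — frozen wells carry no red-shift, trapping / superradiant losses are gauge-blind
(`SbierskiTrappingObstruction`, `KerrSuperradiance` barriers), no late well may nucleate, no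
admissible datum with trapped wells may radiate forever or keep a future-complete null ray inside
a hole; nonlinear Kerr stability is known only for `|a| ≪ M`.  Sources: ChristodoulouKlainerman1993,
doi:10.1007/bf01209300, doi:10.1103/PhysRevD.57.4728, doi:10.1103/PhysRevD.78.064020,
arXiv:gr-qc/9604040, arXiv:0811.0354, arXiv:2104.08222, arXiv:2104.11857, arXiv:2205.14808,
arXiv:1710.01722. -/
theorem stub_trumpetLimits :
  ∀ (X : Type) [TopologicalSpace X] [ChartedSpace E3 X] [IsManifold (𝓡 3) ∞ X] [T2Space X]
    [SecondCountableTopology X] [ConnectedSpace X] (D : InitialDataSet (𝓡 3) X),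
    D ∈ admissibleVacuumData X → ∀ 𝒟 : VacuumCauchyDevelopment D, 𝒟.IsMaximal →
    Summit.FinalStateConjecture.HasCompleteNullInfinity 𝒟.toCauchyDevelopment →
    ∀ (F : ℝ × X → 𝒟.carrier) (ν : ∀ t : ℝ, NormalField (𝓡 4) (fun x : X ↦ F (t, x))),
    𝒟.IsNormalisedMaximalFoliation F ν → 𝒟.HasTrappedWells F ν →
    ∃ (n : ℕ) (U : Fin n → Opens E4) (γ : ∀ i, LorentzianMetric 𝓘(ℝ, E4) ∞ (U i))
      (b : Fin n → E4 → E4 →L[ℝ] E4 →L[ℝ] ℝ) (ρ : Fin n → E4 → ℝ) (Φ : ∀ i, U i → 𝒟.carrier)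
      (R : Fin n → ℝ → ℝ) (U₀ : Opens E4) (Φ₀ : U₀ → 𝒟.carrier) (τ₀ : ℝ) (ξ : Fin n → ℝ → E3)
      (v : Fin n → E3) (ς : Fin n → ℝ → ℝ),
      (∀ i, IsTrumpetModel (U i) (γ i)) ∧
      LeafAdaptedModelCharts 𝒟 F n U γ b ρ Φ R U₀ Φ₀ τ₀ ξ v ς ∧
      ∀ T : ℝ, τ₀ ≤ T →
        Summit.FinalStateConjecture.RaysStayInClosure 𝒟.toCauchyDevelopment
          (Summit.FinalStateConjecture.exteriorOf 𝒟.toCauchyDevelopment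
            (Φ₀ '' (Minkowski.backgroundOn U₀).lateRegion T)) := by
  sorry

/-- **Registered stub 2 — TRUMPET-KID RIGIDITY** (open problem; BY DEFINITION the sibling crux
`Theses.LapseTrumpetKID.TrumpetKIDRigidity`, stmt-FinalStateConjecture-10161: the bodies of
`IsTrumpetModel` / `IsKerrEmbeddedStationary` are that item's hypothesis / conclusion verbatim,
`Iff.rfl` — see the `example` after `Registered`).  An x⁰-stationary vacuum trumpet model `(U, γ)`
embeds time-equivariantly into SUB-EXTREMAL Kerr–Schild Kerr: `∃ (M, a)`, `|a| < M`, `c > 0` and a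
smooth injective `χ : U → ℝ⁴`, `χ(U) ⊆ {r > 0}`, `χ(U) ⊇ {r > r₁}` for some `r₁ < r₊`,
`χ^* g_{M,a} = γ`, `χ (x + s ∂₀) = χ x + (c s) ∂₀` (the Killing development of a trumpet KID is a
`T`-invariant region `{r > r_c(θ)}` of Kerr; the trapped dying-lapse end excludes extremal throats,
white-hole trumpets and solitons; the AF end excludes NUT charge).  Why it might fail: contains
smooth (non-analytic) stationary vacuum black-hole uniqueness for holes admitting trumpet maximal
slicings (Ionescu–Klainerman non-extension barrier): unconditional only if static (Bunting–Masood),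
axisymmetric (Carter–Robinson) or near Kerr (Alexakis–Ionescu–Klainerman); a smooth non-Kerr
stationary vacuum trumpet KID refutes it.  Sources: doi:10.1007/BF00770326, arXiv:gr-qc/9604040,
ChruscielCosta2008, arXiv:0904.0982, arXiv:1108.3575, doi:10.1103/PhysRevLett.113.261101,
Literature.Barriers.FinalStateConjecture.IonescuKlainermanNonExtension. -/
theorem stub_trumpetKIDRigidity :
  ∀ (U : Opens E4) (γ : LorentzianMetric 𝓘(ℝ, E4) ∞ U),
    IsTrumpetModel U γ → IsKerrEmbeddedStationary U γ := by
  sorry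

/-- **Registered stub 3 — SLICE DICTIONARY, T2 form** (XL; the support item
stmt-FinalStateConjecture-10162 `SliceDictionary` with its conclusion upgraded to the T2 clause,
orientation half, as the route header requires "at the split").  For an admissible `D`, an MGHD
`𝒟`, a normalised maximal Cauchy foliation `(F, ν)` and `n` Kerr-embedded
(`IsKerrEmbeddedStationary`) x⁰-stationary vacuum trumpet models `(Uᵢ, γᵢ)` with leaf-adapted late
model charts `LeafAdaptedModelCharts 𝒟 F n U γ b ρ Φ R U₀ Φ₀ τ₀ ξ v ς`, there are `O` and a typed
`d : FinalStateDecomposition 𝒟 O 2` with SUB-EXTREMAL parameters, `O = exteriorOf 𝒟 d.charted`,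
RETAINING THE RADIATION ZONE (`Φ₀ '' {x⁰ > T} ⊆ d.charted` for some `T ≥ τ₀` — the flat chart of `d`
is `Φ₀` on `U₀` from a later time on), with `HasExhaustiveCharts d` and `IsFutureOriented d`.
Intended proof (route header, card P3): hole charts `Ψᵢ := Φᵢ ∘ χᵢ⁻¹ ∘ (Λᵢ, 0)` restricted and
horizon-normalised to the boosted Kerr–Schild exteriors `{t*ᵢ > τ₀', rᵢ > r₊}`, motions the pure
boosts `Λᵢ = boost(vᵢ)` (orthochronous), excision radii `C(ςᵢ + o(t)) + |aᵢ| + 1 = o(t)` so that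
`U₀` qualifies as flat domain and `Φ₀` as flat chart; `C²` control transfers along the FIXED `χᵢ⁻¹` on
compacta (`truncDeviationCk` of `Ψᵢ` from boosted Kerr ≤ constants × that of `Φᵢ` from `γᵢ = χᵢ^* g`);
exhaustion of `O` from the exhaustion clause of the charts (points of `O` are exterior: they signal
into `d.charted`); FUTURE ORIENTATION: the foliation time `t` is a time function whose future side
is `τ_𝒟` (`ν` future, `N > 0` give `dt(w) > 0` exactly for future causal `w`), leaf-adaptedness makes
model time `x⁰` equal to `t`, `c > 0` in the Kerr embedding makes `x⁰ ∘ χ⁻¹` increase along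
`V = −g♯_{M,a}(dt*)`, and `C²`-closeness makes the push-forwards causal eventually, so
`dΨᵢ(Λᵢ V)` and `dΦ₀(∂₀)` are future-directed.  Why it might fail / cost: the horizon normalisation
(the exhaustion clause of `HasExhaustiveCharts` is relative to the `r > r₊` parts of the slabs while
the hypothesis certifies trumpet truncations reaching inside the horizon; exterior points in the
past of neck points must be shown to lie in the past of the exterior certified slab), the `o(t)`
bookkeeping of tracks vs straight world-lines `t vᵢ` inside `poincareInv`, and the operator-norm
`C²` transfer along `χᵢ⁻¹` are long but elementary; no open problem is hidden here once stub 2 has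
supplied `χᵢ`.  Sources: arXiv:2104.08222 §1, arXiv:1710.01722, doi:10.1103/PhysRevD.98.044014,
arXiv:0811.0354 §5.1, ONeill1983 Ch. 5 p. 145. -/
theorem stub_sliceDictionary :
  ∀ (X : Type) [TopologicalSpace X] [ChartedSpace E3 X] [IsManifold (𝓡 3) ∞ X] [T2Space X]
    [SecondCountableTopology X] [ConnectedSpace X] (D : InitialDataSet (𝓡 3) X),
    D ∈ admissibleVacuumData X → ∀ 𝒟 : VacuumCauchyDevelopment D, 𝒟.IsMaximal →
    ∀ (F : ℝ × X → 𝒟.carrier) (ν : ∀ t : ℝ, NormalField (𝓡 4) (fun x : X ↦ F (t, x))),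
    𝒟.IsNormalisedMaximalFoliation F ν →
    ∀ (n : ℕ) (U : Fin n → Opens E4) (γ : ∀ i, LorentzianMetric 𝓘(ℝ, E4) ∞ (U i))
      (b : Fin n → E4 → E4 →L[ℝ] E4 →L[ℝ] ℝ) (ρ : Fin n → E4 → ℝ) (Φ : ∀ i, U i → 𝒟.carrier)
      (R : Fin n → ℝ → ℝ) (U₀ : Opens E4) (Φ₀ : U₀ → 𝒟.carrier) (τ₀ : ℝ) (ξ : Fin n → ℝ → E3)
      (v : Fin n → E3) (ς : Fin n → ℝ → ℝ),
    (∀ i, IsTrumpetModel (U i) (γ i)) → (∀ i, IsKerrEmbeddedStationary (U i) (γ i)) →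
    LeafAdaptedModelCharts 𝒟 F n U γ b ρ Φ R U₀ Φ₀ τ₀ ξ v ς →
    ∃ (O : Set 𝒟.carrier) (d : FinalStateDecomposition 𝒟.toSpacetime O 2),
      (∀ i, Kerr.IsSubextremal (d.mass i) (d.spin i)) ∧
      O = Summit.FinalStateConjecture.exteriorOf 𝒟.toCauchyDevelopment d.charted ∧
      (∃ T : ℝ, τ₀ ≤ T ∧ Φ₀ '' (Minkowski.backgroundOn U₀).lateRegion T ⊆ d.charted) ∧
      Summit.FinalStateConjecture.HasExhaustiveCharts d ∧
      Summit.FinalStateConjecture.IsFutureOriented d := by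
  sorry

/-! ## Registered stub signatures (by name, for `ledger skeleton check` / `#h21_check_skeleton`)

Each `Registered.stub_<name>` is the statement of the theorem `stub_<name>` above, verbatim, so that
the composition takes its hypotheses BY NAME (checked by ascription below). -/
namespace Registered

/-- Registered signature of `stub_trumpetLimits` (verbatim). -/
abbrev stub_trumpetLimits : Prop :=
  ∀ (X : Type) [TopologicalSpace X] [ChartedSpace E3 X] [IsManifold (𝓡 3) ∞ X] [T2Space X]
    [SecondCountableTopology X] [ConnectedSpace X] (D : InitialDataSet (𝓡 3) X),
    D ∈ admissibleVacuumData X → ∀ 𝒟 : VacuumCauchyDevelopment D, 𝒟.IsMaximal →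
    Summit.FinalStateConjecture.HasCompleteNullInfinity 𝒟.toCauchyDevelopment →
    ∀ (F : ℝ × X → 𝒟.carrier) (ν : ∀ t : ℝ, NormalField (𝓡 4) (fun x : X ↦ F (t, x))),
    𝒟.IsNormalisedMaximalFoliation F ν → 𝒟.HasTrappedWells F ν →
    ∃ (n : ℕ) (U : Fin n → Opens E4) (γ : ∀ i, LorentzianMetric 𝓘(ℝ, E4) ∞ (U i))
      (b : Fin n → E4 → E4 →L[ℝ] E4 →L[ℝ] ℝ) (ρ : Fin n → E4 → ℝ) (Φ : ∀ i, U i → 𝒟.carrier)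
      (R : Fin n → ℝ → ℝ) (U₀ : Opens E4) (Φ₀ : U₀ → 𝒟.carrier) (τ₀ : ℝ) (ξ : Fin n → ℝ → E3)
      (v : Fin n → E3) (ς : Fin n → ℝ → ℝ),
      (∀ i, IsTrumpetModel (U i) (γ i)) ∧
      LeafAdaptedModelCharts 𝒟 F n U γ b ρ Φ R U₀ Φ₀ τ₀ ξ v ς ∧
      ∀ T : ℝ, τ₀ ≤ T →
        Summit.FinalStateConjecture.RaysStayInClosure 𝒟.toCauchyDevelopment
          (Summit.FinalStateConjecture.exteriorOf 𝒟.toCauchyDevelopment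
            (Φ₀ '' (Minkowski.backgroundOn U₀).lateRegion T))

/-- Registered signature of `stub_trumpetKIDRigidity` (verbatim). -/
abbrev stub_trumpetKIDRigidity : Prop :=
  ∀ (U : Opens E4) (γ : LorentzianMetric 𝓘(ℝ, E4) ∞ U),
    IsTrumpetModel U γ → IsKerrEmbeddedStationary U γ

/-- Registered signature of `stub_sliceDictionary` (verbatim). -/
abbrev stub_sliceDictionary : Prop :=
  ∀ (X : Type) [TopologicalSpace X] [ChartedSpace E3 X] [IsManifold (𝓡 3) ∞ X] [T2Space X]
    [SecondCountableTopology X] [ConnectedSpace X] (D : InitialDataSet (𝓡 3) X),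
    D ∈ admissibleVacuumData X → ∀ 𝒟 : VacuumCauchyDevelopment D, 𝒟.IsMaximal →
    ∀ (F : ℝ × X → 𝒟.carrier) (ν : ∀ t : ℝ, NormalField (𝓡 4) (fun x : X ↦ F (t, x))),
    𝒟.IsNormalisedMaximalFoliation F ν →
    ∀ (n : ℕ) (U : Fin n → Opens E4) (γ : ∀ i, LorentzianMetric 𝓘(ℝ, E4) ∞ (U i))
      (b : Fin n → E4 → E4 →L[ℝ] E4 →L[ℝ] ℝ) (ρ : Fin n → E4 → ℝ) (Φ : ∀ i, U i → 𝒟.carrier)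
      (R : Fin n → ℝ → ℝ) (U₀ : Opens E4) (Φ₀ : U₀ → 𝒟.carrier) (τ₀ : ℝ) (ξ : Fin n → ℝ → E3)
      (v : Fin n → E3) (ς : Fin n → ℝ → ℝ),
    (∀ i, IsTrumpetModel (U i) (γ i)) → (∀ i, IsKerrEmbeddedStationary (U i) (γ i)) →
    LeafAdaptedModelCharts 𝒟 F n U γ b ρ Φ R U₀ Φ₀ τ₀ ξ v ς →
    ∃ (O : Set 𝒟.carrier) (d : FinalStateDecomposition 𝒟.toSpacetime O 2),
      (∀ i, Kerr.IsSubextremal (d.mass i) (d.spin i)) ∧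
      O = Summit.FinalStateConjecture.exteriorOf 𝒟.toCauchyDevelopment d.charted ∧
      (∃ T : ℝ, τ₀ ≤ T ∧ Φ₀ '' (Minkowski.backgroundOn U₀).lateRegion T ⊆ d.charted) ∧
      Summit.FinalStateConjecture.HasExhaustiveCharts d ∧
      Summit.FinalStateConjecture.IsFutureOriented d

end Registered

/-- The registered signatures ARE the statements of the three `stub_*` theorems (checked by
ascription; these `example`s elaborate no `sorry` of their own). -/
example : Registered.stub_trumpetLimits := stub_trumpetLimits
example : Registered.stub_trumpetKIDRigidity := stub_trumpetKIDRigidity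
example : Registered.stub_sliceDictionary := stub_sliceDictionary

/-- Stub 2 IS the sibling crux `TrumpetKIDRigidity` (stmt-FinalStateConjecture-10161) of the same
route, definitionally: `IsTrumpetModel` / `IsKerrEmbeddedStationary` were vendored verbatim from
that item (`isTrumpetModel_iff`, `isKerrEmbeddedStationary_iff` are `Iff.rfl`). -/
example : Registered.stub_trumpetKIDRigidity ↔ Theses.LapseTrumpetKID.TrumpetKIDRigidity :=
  Iff.rfl

/-! ## The composition: the crux BY NAME from the three stub statements (no `sorry`) -/

/-- **`SettlingInMaximalGauge` from the three stubs, BY NAME.**  Given the crux hypotheses — an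
admissible datum `D`, an MGHD `𝒟` with complete `𝓘⁺`, a map `F : ℝ × X → 𝒟` with normals `ν`
satisfying the inline clauses "normalised maximal Cauchy foliation" and "wells trapped" — :
(1) the inline clauses are `𝒟.IsNormalisedMaximalFoliation F ν` and `𝒟.HasTrappedWells F ν`
(`Spacetime.isNormalisedMaximalFoliation_iff`, `Spacetime.hasTrappedWells_iff`, both `Iff.rfl`);
(2) `stub_trumpetLimits` yields trumpet models `(Uᵢ, γᵢ)`, leaf-adapted charts and the rays clause
relative to the late radiation zone; (3) `stub_trumpetKIDRigidity` Kerr-embeds each model;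
(4) `stub_sliceDictionary` yields `O`, `d` with `O = exteriorOf 𝒟 d.charted`, radiation-zone
retention `Φ₀ '' {x⁰ > T} ⊆ d.charted` (`T ≥ τ₀`), `HasExhaustiveCharts d`, `IsFutureOriented d`;
(5) the rays clause at level `T` is transported to `O` along
`exteriorOf 𝒟 (Φ₀ '' {x⁰ > T}) ⊆ exteriorOf 𝒟 d.charted = O` (`exteriorOf_mono`,
`raysStayInClosure_mono`).  Sub-extremality supplied by stub 3 is not part of this crux (it is the
sibling crux `TrappedWellsSubextremal`'s business in `closes`) and is dropped. -/
theorem SettlingInMaximalGauge_of (h₁ : Registered.stub_trumpetLimits)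
    (h₂ : Registered.stub_trumpetKIDRigidity) (h₃ : Registered.stub_sliceDictionary) :
    Theses.LapseTrumpetKID.SettlingInMaximalGauge := by
  intro X _ _ _ _ _ _ D hD 𝒟 hmax hscri F ν hfol hwells
  -- (1) the inline clauses of the crux are the named Literature predicates (definitional)
  have hfol' : 𝒟.IsNormalisedMaximalFoliation F ν :=
    (Spacetime.isNormalisedMaximalFoliation_iff F ν).2 hfol
  have hwells' : 𝒟.HasTrappedWells F ν := (Spacetime.hasTrappedWells_iff F ν).2 hwells
  -- (2) trumpet limits along the foliation, with the rays clause
  obtain ⟨n, U, γ, b, ρ, Φ, R, U₀, Φ₀, τ₀, ξ, v, ς, hmodel, hcharts, hrays⟩ :=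
    h₁ X D hD 𝒟 hmax hscri F ν hfol' hwells'
  -- (3) rigidity: every limit model is a region of sub-extremal Kerr
  have hkerr : ∀ i, IsKerrEmbeddedStationary (U i) (γ i) := fun i ↦ h₂ (U i) (γ i) (hmodel i)
  -- (4) the dictionary to the typed decomposition
  obtain ⟨O, d, -, hO, ⟨T, hT, hrad⟩, hEx, hFO⟩ :=
    h₃ X D hD 𝒟 hmax F ν hfol' n U γ b ρ Φ R U₀ Φ₀ τ₀ ξ v ς hmodel hkerr hcharts
  refine ⟨O, d, hO, ?_, hEx, hFO⟩
  -- (5) transport of the rays clause from the radiation zone's exterior region to `O`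
  rw [hO]
  exact raysStayInClosure_mono 𝒟.toCauchyDevelopment (exteriorOf_mono 𝒟.toCauchyDevelopment hrad)
    (hrays T hT)

/-- The crux by name, closed modulo the three registered stubs (uses `sorry` only through
`stub_*`; becomes the crux proof verbatim once the stubs land). -/
theorem settlingInMaximalGauge_of_stubs : Theses.LapseTrumpetKID.SettlingInMaximalGauge :=
  SettlingInMaximalGauge_of stub_trumpetLimits stub_trumpetKIDRigidity stub_sliceDictionary


end Summit.FinalStateConjecture.FinalStateConjecture.Cruxes.SettlingInMaximalGauge.Birth

end
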